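import Literature.MathematicalPhysics.QuantumFieldTheory.Balaban1983to89.BlockAveragingSU2
import Mathlib.Analysis.SpecialFunctions.Complex.Analytic
import Mathlib.Analysis.SpecialFunctions.ExpDeriv
import Mathlib.Analysis.SpecialFunctions.Pow.Real
import Mathlib.Analysis.Analytic.Linear
import Mathlib.Topology.Algebra.Module.FiniteDimension
import HarnessLib

/-!
# The `Gᶜ = SL(2,ℂ)` extension and the analyticity of the quaternionic projected mean (Bałaban [B12] §0, p. 253)

Companion to `BlockAveragingSU2.lean` (the cell's concrete small-loop average `su2Mean` on `SU(2)`, built from the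
quaternionic projected mean `SU2Mean.mean W = (det Σ_i W_i)^{-1/2} Σ_i W_i`) and to `BlockAveragingSU2FirstOrder.lean`
((0.8) for that mean).  This file settles, for that ONE concrete averaging operation, the remaining clause of the
preamble of Bałaban's axioms (0.5)–(0.9), which both earlier headers list as NOT ENCODED: the average is a
`Gᶜ`-valued ANALYTIC function of families of `Gᶜ`-elements of small diameter.

## The source text (B12 = Bałaban, Commun. Math. Phys. 109 (1987) 249–301, §0 p. 253; quoted from the page render)

«Thus we have to define an average of a finite set of group elements. We introduce an axiomatric definition of such
an average. It is a Gᶜ-valued function defined on sets {U_j : j = 1, 2, ..., n}, U_j ∈ Gᶜ, with sufficiently small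
diameters. We denote it by {U_j}‾ = M({U_j}), and we assume that it is an analytic function having the following
properties: M({U_j⁻¹}) = M({U_j})⁻¹; (0.5) M({uU_jv}) = uM({U_j})v; (0.6) M(π{U_j}) = M({U_j}) for an arbitrary
permutation π of the set {U_j}; (0.7)» … «if U_j ∈ G, then M({U_j}) ∈ G also. (0.9)» (sic «axiomatric»).

## What is DEFINED and PROVED here (for `G = SU(2)`, `Gᶜ = SL(2,ℂ)`; nothing printed is asserted)

* §1 `SU2Mean.invSqrt d = exp(-½ log d)` (principal branch of `d^{-1/2}`; `invSqrt d ^ 2 * d = 1` for `d ≠ 0`,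
  `invSqrt r = (√r)⁻¹` for real `r > 0`), `SU2Mean.projMatC q = (det q)^{-1/2} • q` (value `1` on `det q = 0`, the
  parent's junk value), `SU2Mean.qsumC W = Σ_j W_j` and the COMPLEX EXTENSION `SU2Mean.meanC W = projMatC (Σ_j W_j)`
  on families `W : ι → Matrix (Fin 2) (Fin 2) ℂ`; RESTRICTION: `meanC (↑∘W) = ↑(mean W)` for every `SU(2)`-family
  (`meanC_coe`) — so `meanC` extends exactly the inhabitant `su2Mean` of the parent module.
* §2 «Gᶜ-valued»: `det (meanC W) = 1` for EVERY family (`det_meanC`; packaged `meanSL W : SL(2,ℂ)`), and the axioms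
  on `SL(2,ℂ)`-families: (0.5) `meanC {W_j⁻¹} = (meanC W)⁻¹` whenever `det W_j = 1 ∀ j` (`meanC_inv`; the 2×2
  adjugate `adj A = tr A • 1 - A` is additive), (0.6) TWO-SIDED `meanC {u W_j v} = u (meanC W) v` for
  `u v ∈ SL(2,ℂ)` off the exceptional set `det Σ_j W_j = 0` (`meanC_mul_mul`), (0.7) reindexing invariance
  (`meanC_comp_equiv`), (0.9) `W_j ∈ SU(2) ∀ j ⇒ meanC W ∈ SU(2)` (`meanC_coe_mem`, via the restriction lemma).
* §3 «analytic function»: `meanC` is `ℂ`-ANALYTIC (Mathlib `AnalyticAt ℂ`, jointly in `W ∈ ι → M₂(ℂ)`) at every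
  family whose `det Σ_j W_j` lies in `Complex.slitPlane` (`analyticAt_meanC`, `analyticOnNhd_meanC`; the set is open,
  `isOpen_regularSet`), in particular at every `SU(2)`-family off the exceptional set (`analyticAt_meanC_coe`).
* §4 «sufficiently small diameters», explicitly: if `‖U₀⁻¹ W_j - 1‖ ≤ η ≤ 1/3` for all `j` and some `U₀ ∈ SL(2,ℂ)`
  (a family of diameter `≲ η` around `U₀` in the left-invariant operator-norm chart) then
  `Re det Σ_j U₀⁻¹W_j > 0`, so `det Σ_j W_j ∈ slitPlane` and `meanC` is analytic there
  (`det_qsumC_re_pos_of_near_one`, `det_qsumC_mem_slitPlane_of_near`, `analyticAt_meanC_of_near`).  The constant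
  `1/3` is this FILE's sufficient constant (from `det(1 + D) = 1 + tr D + det D`, `|tr D| ≤ 2‖D‖`, `|det D| ≤ 2‖D‖²`),
  not the paper's.

## Honest scope

NOT claimed: that `meanC` is Bałaban's (0.4) `exp[mean log]` or Federbush's implicit average (0.10) (it is not —
DIVERGENCE D-pv26g2.4 of the cell; the paper declares the choice immaterial: «The considerations and results of this,
and previous papers, do not depend on any particular averaging operation used; they are valid universally for all
averages satisfying the above properties.», p. 253); uniqueness of the analytic extension; (0.5)/(0.6) on the
exceptional set `det Σ_j W_j = 0` (where the junk value `1` is used; every family with `sup_j ‖U₀⁻¹W_j - 1‖ ≤ 1/3`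
avoids it, §4); (0.8) for `meanC` beyond `SU(2)`-families (see `BlockAveragingSU2FirstOrder.lean` on `SU(2)`).
With the two companion files the printed list — `Gᶜ`-valued, analytic on small-diameter families, (0.5), (0.6), (0.7),
(0.8), (0.9) — is kernel-verified for the cell's `SU(2)` inhabitant, each item in the precise form stated in the
respective file.  Value = kernel property of the cell's inhabitant, NOT summit progress.
-/

noncomputable section

open scoped Matrix.Norms.L2Operator ComplexOrder

namespace Literature.MathematicalPhysics.QuantumFieldTheory.Balaban1983to89

open Literature.Computability.QuantumComplexity (adjugate_fin_two_eq_trace_smul_sub)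
open Literature.Computability.QuantumComplexity.SolovayKitaev (norm_apply_le_norm)

namespace SU2Mean

variable {ι : Type*} [Fintype ι]

/-! ## 1. The complex extension of the projected mean -/

/-- The principal branch of `d ↦ d^{-1/2}`: `invSqrt d = exp(-½ log d)` (at `d = 0`, where Mathlib's `log 0 = 0`,
the value is `1`). [folklore] -/
def invSqrt (d : ℂ) : ℂ := Complex.exp (-(2⁻¹ : ℂ) * Complex.log d)

/-- `invSqrt d` never vanishes. [folklore] -/
theorem invSqrt_ne_zero (d : ℂ) : invSqrt d ≠ 0 := Complex.exp_ne_zero _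

/-- `(d^{-1/2})² · d = 1` for `d ≠ 0`. [folklore] -/
theorem invSqrt_sq_mul (d : ℂ) (hd : d ≠ 0) : invSqrt d ^ 2 * d = 1 := by
  unfold invSqrt
  rw [sq, ← Complex.exp_add, show -(2⁻¹ : ℂ) * Complex.log d + -(2⁻¹ : ℂ) * Complex.log d = -Complex.log d by ring,
    Complex.exp_neg, Complex.exp_log hd, inv_mul_cancel₀ hd]

/-- On the positive reals the principal branch is the real one: `invSqrt r = (√r)⁻¹`. [folklore] -/
theorem invSqrt_ofReal {r : ℝ} (hr : 0 < r) : invSqrt (r : ℂ) = (((Real.sqrt r)⁻¹ : ℝ) : ℂ) := by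
  unfold invSqrt
  rw [← Complex.ofReal_log hr.le,
    show -(2⁻¹ : ℂ) * ((Real.log r : ℝ) : ℂ) = ((-(2⁻¹ : ℝ) * Real.log r : ℝ) : ℂ) by push_cast; ring,
    ← Complex.ofReal_exp]
  congr 1
  rw [Real.sqrt_eq_rpow, Real.rpow_def_of_pos hr, ← Real.exp_neg]
  congr 1
  ring

/-- The complex projected mean of a `2×2` complex matrix: `projMatC q = (det q)^{-1/2} • q` (principal branch), with
the parent module's junk value `1` on `det q = 0`. [folklore] -/
def projMatC (q : Matrix (Fin 2) (Fin 2) ℂ) : Matrix (Fin 2) (Fin 2) ℂ :=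
  if q.det = 0 then 1 else invSqrt q.det • q

/-- The exceptional branch. [folklore] -/
theorem projMatC_of_eq {q : Matrix (Fin 2) (Fin 2) ℂ} (h : q.det = 0) : projMatC q = 1 := if_pos h

/-- The regular branch. [folklore] -/
theorem projMatC_of_ne {q : Matrix (Fin 2) (Fin 2) ℂ} (h : q.det ≠ 0) : projMatC q = invSqrt q.det • q := if_neg h

/-- `projMatC` agrees with the parent's real-branch `projMat` on matrices with real non-negative determinant (the
quaternion matrices `Σ_i W_i`, `W_i ∈ SU(2)`). [folklore] -/
theorem projMatC_eq_projMat (q : Matrix (Fin 2) (Fin 2) ℂ) (hre : q.det = ((q.det.re : ℝ) : ℂ))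
    (hnn : 0 ≤ q.det.re) : projMatC q = projMat q := by
  by_cases h : q.det = 0
  · rw [projMatC_of_eq h, projMat_of_eq h]
  · have hre0 : q.det.re ≠ 0 := fun h0 => h (by rw [hre, h0]; simp)
    have hpos : 0 < q.det.re := lt_of_le_of_ne hnn (Ne.symm hre0)
    have hc : invSqrt q.det = (((Real.sqrt q.det.re)⁻¹ : ℝ) : ℂ) := by
      rw [hre, invSqrt_ofReal hpos, Complex.ofReal_re]
    rw [projMatC_of_ne h, projMat_of_ne h, hc]

/-- The sum of a family of complex `2×2` matrices. [folklore] -/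
def qsumC (W : ι → Matrix (Fin 2) (Fin 2) ℂ) : Matrix (Fin 2) (Fin 2) ℂ := ∑ j, W j

/-- **The complex extension of the quaternionic projected mean**: `meanC W = (det Σ_j W_j)^{-1/2} Σ_j W_j` on families
of complex `2×2` matrices (value `1` on `det Σ_j W_j = 0`). [folklore] -/
def meanC (W : ι → Matrix (Fin 2) (Fin 2) ℂ) : Matrix (Fin 2) (Fin 2) ℂ := projMatC (qsumC W)

/-- On `SU(2)`-families `qsumC` is the parent's `qsum`. [folklore] -/
theorem qsumC_coe (W : ι → Matrix.specialUnitaryGroup (Fin 2) ℂ) :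
    qsumC (fun j => (W j : Matrix (Fin 2) (Fin 2) ℂ)) = qsum W := rfl

/-- **Restriction**: on `SU(2)`-families the complex extension IS the cell's projected mean `SU2Mean.mean`
(the inhabitant `su2Mean.E` of `BlockAveragingSU2.lean`), everywhere (including the exceptional set). [folklore] -/
theorem meanC_coe (W : ι → Matrix.specialUnitaryGroup (Fin 2) ℂ) :
    meanC (fun j => (W j : Matrix (Fin 2) (Fin 2) ℂ)) = (mean W : Matrix (Fin 2) (Fin 2) ℂ) := by
  rw [coe_mean]
  exact projMatC_eq_projMat _ (det_qsum_eq_ofReal W) (det_qsum_re_nonneg W)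

/-! ## 2. `Gᶜ`-valuedness and the axioms (0.5), (0.6), (0.7), (0.9) on `SL(2,ℂ)`-families -/

/-- `projMatC q` always has determinant `1`. [folklore] -/
theorem det_projMatC (q : Matrix (Fin 2) (Fin 2) ℂ) : (projMatC q).det = 1 := by
  by_cases h : q.det = 0
  · rw [projMatC_of_eq h, Matrix.det_one]
  · rw [projMatC_of_ne h, Matrix.det_smul, Fintype.card_fin, invSqrt_sq_mul _ h]

/-- «It is a Gᶜ-valued function»: `det (meanC W) = 1` for every family of complex `2×2` matrices
(`Gᶜ = SL(2,ℂ)` for `G = SU(2)`). [cite: Balaban1987RG1, §0 p.253] -/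
theorem det_meanC (W : ι → Matrix (Fin 2) (Fin 2) ℂ) : (meanC W).det = 1 := det_projMatC _

/-- The complex extension packaged as an `SL(2,ℂ)`-valued map. [cite: Balaban1987RG1, §0 p.253] -/
def meanSL (W : ι → Matrix (Fin 2) (Fin 2) ℂ) : Matrix.SpecialLinearGroup (Fin 2) ℂ := ⟨meanC W, det_meanC W⟩

/-- The matrix of `meanSL W`. [folklore] -/
@[simp] theorem coe_meanSL (W : ι → Matrix (Fin 2) (Fin 2) ℂ) :
    (meanSL W : Matrix (Fin 2) (Fin 2) ℂ) = meanC W := rfl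

/-- (0.7) for the complex extension: invariance under re-indexing of the family. [cite: Balaban1987RG1, (0.7) p.253] -/
theorem qsumC_comp_equiv {ι' : Type*} [Fintype ι'] (σ : ι' ≃ ι) (W : ι → Matrix (Fin 2) (Fin 2) ℂ) :
    qsumC (W ∘ σ) = qsumC W := by
  unfold qsumC
  exact Equiv.sum_comp σ W

/-- **(0.7)** `M(π{U_j}) = M({U_j})` for the complex extension. [cite: Balaban1987RG1, (0.7) p.253] -/
theorem meanC_comp_equiv {ι' : Type*} [Fintype ι'] (σ : ι' ≃ ι) (W : ι → Matrix (Fin 2) (Fin 2) ℂ) :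
    meanC (W ∘ σ) = meanC W := by
  unfold meanC
  rw [qsumC_comp_equiv]

/-- Two-sided multiplication passes through the sum. [folklore] -/
theorem qsumC_mul_mul (u v : Matrix (Fin 2) (Fin 2) ℂ) (W : ι → Matrix (Fin 2) (Fin 2) ℂ) :
    qsumC (fun j => u * W j * v) = u * qsumC W * v := by
  unfold qsumC
  rw [Finset.mul_sum, Finset.sum_mul]

/-- **(0.6), two-sided, on `SL(2,ℂ)`**: `M({uU_jv}) = uM({U_j})v` for `u v ∈ SL(2,ℂ)`, off the exceptional set
`det Σ_j U_j = 0`. [cite: Balaban1987RG1, (0.6) p.253] -/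
theorem meanC_mul_mul (u v : Matrix (Fin 2) (Fin 2) ℂ) (hu : u.det = 1) (hv : v.det = 1)
    (W : ι → Matrix (Fin 2) (Fin 2) ℂ) (hW : (qsumC W).det ≠ 0) :
    meanC (fun j => u * W j * v) = u * meanC W * v := by
  have hdet : (u * qsumC W * v).det = (qsumC W).det := by
    rw [Matrix.det_mul, Matrix.det_mul, hu, hv, one_mul, mul_one]
  unfold meanC
  rw [qsumC_mul_mul, projMatC_of_ne (by rwa [hdet]), projMatC_of_ne hW, hdet]
  simp only [Matrix.mul_smul, Matrix.smul_mul]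

/-- In `SL(2,ℂ)` the inverse is the adjugate. [folklore] -/
theorem inv_eq_adjugate_of_det_eq_one (A : Matrix (Fin 2) (Fin 2) ℂ) (hA : A.det = 1) : A⁻¹ = A.adjugate := by
  rw [Matrix.inv_def, hA, Ring.inverse_one, one_smul]

/-- The `2×2` adjugate is additive: `Σ_j adj W_j = adj Σ_j W_j`, hence `Σ_j W_j⁻¹ = adj (Σ_j W_j)` on
`SL(2,ℂ)`-families. [folklore] -/
theorem qsumC_inv (W : ι → Matrix (Fin 2) (Fin 2) ℂ) (hW : ∀ j, (W j).det = 1) :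
    qsumC (fun j => (W j)⁻¹) = (qsumC W).adjugate := by
  unfold qsumC
  simp_rw [inv_eq_adjugate_of_det_eq_one _ (hW _), adjugate_fin_two_eq_trace_smul_sub]
  rw [Finset.sum_sub_distrib, ← Finset.sum_smul, ← Matrix.trace_sum]

/-- **(0.5) on `SL(2,ℂ)`**: `M({U_j⁻¹}) = M({U_j})⁻¹` for every family with `det U_j = 1 ∀ j` (both branches).
[cite: Balaban1987RG1, (0.5) p.253] -/
theorem meanC_inv (W : ι → Matrix (Fin 2) (Fin 2) ℂ) (hW : ∀ j, (W j).det = 1) :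
    meanC (fun j => (W j)⁻¹) = (meanC W)⁻¹ := by
  unfold meanC
  rw [qsumC_inv W hW]
  have hdet : ((qsumC W).adjugate).det = (qsumC W).det := by
    rw [Matrix.det_adjugate, Fintype.card_fin]
    simp
  by_cases h : (qsumC W).det = 0
  · rw [projMatC_of_eq (by rw [hdet, h]), projMatC_of_eq h, inv_one]
  · rw [projMatC_of_ne (by rwa [hdet]), projMatC_of_ne h, hdet, Matrix.inv_def, Matrix.det_smul,
      Matrix.adjugate_smul, Fintype.card_fin, invSqrt_sq_mul _ h, Ring.inverse_one, one_smul]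
    simp

/-- **(0.9)** «if U_j ∈ G, then M({U_j}) ∈ G also»: on `SU(2)`-families the complex extension takes values in
`SU(2)`. [cite: Balaban1987RG1, (0.9) p.253] -/
theorem meanC_coe_mem (W : ι → Matrix.specialUnitaryGroup (Fin 2) ℂ) :
    meanC (fun j => (W j : Matrix (Fin 2) (Fin 2) ℂ)) ∈ Matrix.specialUnitaryGroup (Fin 2) ℂ := by
  rw [meanC_coe]
  exact (mean W).2

/-! ## 3. Analyticity -/

/-- The `(a,b)` entry as a continuous linear functional on `2×2` complex matrices (operator-norm topology).
[folklore] -/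
def entryCLM (a b : Fin 2) : Matrix (Fin 2) (Fin 2) ℂ →L[ℂ] ℂ :=
  LinearMap.toContinuousLinearMap (Matrix.entryLinearMap ℂ ℂ a b)

/-- `entryCLM a b A = A a b`. [folklore] -/
@[simp] theorem entryCLM_apply (a b : Fin 2) (A : Matrix (Fin 2) (Fin 2) ℂ) : entryCLM a b A = A a b := rfl

/-- `W ↦ Σ_j W_j` is continuous. [folklore] -/
theorem continuous_qsumC : Continuous (qsumC : (ι → Matrix (Fin 2) (Fin 2) ℂ) → Matrix (Fin 2) (Fin 2) ℂ) := by
  unfold qsumC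
  exact continuous_finsetSum _ fun j _ => continuous_apply j

/-- `W ↦ Σ_j W_j` is analytic (it is continuous linear). [folklore] -/
theorem analyticAt_qsumC (W : ι → Matrix (Fin 2) (Fin 2) ℂ) :
    AnalyticAt ℂ (qsumC : (ι → Matrix (Fin 2) (Fin 2) ℂ) → Matrix (Fin 2) (Fin 2) ℂ) W := by
  show AnalyticAt ℂ (fun W : ι → Matrix (Fin 2) (Fin 2) ℂ => ∑ j ∈ Finset.univ, W j) W
  exact Finset.analyticAt_fun_sum _ fun j _ =>
    (ContinuousLinearMap.proj (R := ℂ) (φ := fun _ : ι => Matrix (Fin 2) (Fin 2) ℂ) j).analyticAt W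

/-- `W ↦ det Σ_j W_j` is analytic (a polynomial in the entries). [folklore] -/
theorem analyticAt_det_qsumC (W : ι → Matrix (Fin 2) (Fin 2) ℂ) :
    AnalyticAt ℂ (fun W : ι → Matrix (Fin 2) (Fin 2) ℂ => (qsumC W).det) W := by
  have e : (fun W : ι → Matrix (Fin 2) (Fin 2) ℂ => (qsumC W).det) = fun W =>
      entryCLM 0 0 (qsumC W) * entryCLM 1 1 (qsumC W) - entryCLM 0 1 (qsumC W) * entryCLM 1 0 (qsumC W) := by
    funext W
    rw [Matrix.det_fin_two]
    rfl
  rw [e]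
  have h := analyticAt_qsumC W
  exact ((((entryCLM 0 0).analyticAt _).comp h).fun_mul (((entryCLM 1 1).analyticAt _).comp h)).fun_sub
    ((((entryCLM 0 1).analyticAt _).comp h).fun_mul (((entryCLM 1 0).analyticAt _).comp h))

/-- The regular set `{W | det Σ_j W_j ∈ ℂ ∖ (-∞,0]}` is open. [folklore] -/
theorem isOpen_regularSet :
    IsOpen {W : ι → Matrix (Fin 2) (Fin 2) ℂ | (qsumC W).det ∈ Complex.slitPlane} :=
  Complex.isOpen_slitPlane.preimage continuous_qsumC.matrix_det

/-- The scalar factor `W ↦ (det Σ_j W_j)^{-1/2}` is analytic on the regular set. [folklore] -/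
theorem analyticAt_invSqrt_det_qsumC {W : ι → Matrix (Fin 2) (Fin 2) ℂ} (hW : (qsumC W).det ∈ Complex.slitPlane) :
    AnalyticAt ℂ (fun W : ι → Matrix (Fin 2) (Fin 2) ℂ => invSqrt (qsumC W).det) W := by
  have h1 : AnalyticAt ℂ (fun W : ι → Matrix (Fin 2) (Fin 2) ℂ => Complex.log (qsumC W).det) W :=
    (analyticAt_det_qsumC W).clog hW
  have h2 : AnalyticAt ℂ (fun W : ι → Matrix (Fin 2) (Fin 2) ℂ => -(2⁻¹ : ℂ) * Complex.log (qsumC W).det) W :=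
    analyticAt_const.fun_mul h1
  exact h2.cexp'

/-- **«we assume that it is an analytic function»** — PROVED for the complex extension of the cell's inhabitant:
`meanC` is `ℂ`-analytic (jointly in all the variables `W_j ∈ M₂(ℂ)`) at every family with
`det Σ_j W_j ∈ ℂ ∖ (-∞,0]`. [cite: Balaban1987RG1, §0 p.253] -/
theorem analyticAt_meanC {W : ι → Matrix (Fin 2) (Fin 2) ℂ} (hW : (qsumC W).det ∈ Complex.slitPlane) :
    AnalyticAt ℂ (meanC : (ι → Matrix (Fin 2) (Fin 2) ℂ) → Matrix (Fin 2) (Fin 2) ℂ) W := by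
  have h : AnalyticAt ℂ (fun W : ι → Matrix (Fin 2) (Fin 2) ℂ => invSqrt (qsumC W).det • qsumC W) W :=
    (analyticAt_invSqrt_det_qsumC hW).fun_smul (analyticAt_qsumC W)
  refine h.congr ?_
  filter_upwards [isOpen_regularSet.mem_nhds hW] with W' hW'
  exact (projMatC_of_ne (Complex.slitPlane_ne_zero hW')).symm

/-- Set form: `meanC` is analytic on the (open) regular set. [cite: Balaban1987RG1, §0 p.253] -/
theorem analyticOnNhd_meanC :
    AnalyticOnNhd ℂ (meanC : (ι → Matrix (Fin 2) (Fin 2) ℂ) → Matrix (Fin 2) (Fin 2) ℂ)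
      {W | (qsumC W).det ∈ Complex.slitPlane} :=
  fun _ hW => analyticAt_meanC hW

/-- In particular `meanC` is complex-differentiable on the regular set. [folklore] -/
theorem differentiableAt_meanC {W : ι → Matrix (Fin 2) (Fin 2) ℂ} (hW : (qsumC W).det ∈ Complex.slitPlane) :
    DifferentiableAt ℂ (meanC : (ι → Matrix (Fin 2) (Fin 2) ℂ) → Matrix (Fin 2) (Fin 2) ℂ) W :=
  (analyticAt_meanC hW).differentiableAt

/-- Every `SU(2)`-family off the exceptional set `Σ_i W_i = 0` is a regular point: the extension is analytic at the
points where it restricts to the inhabitant's regular branch. [folklore] -/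
theorem analyticAt_meanC_coe (W : ι → Matrix.specialUnitaryGroup (Fin 2) ℂ) (hW : (qsum W).det ≠ 0) :
    AnalyticAt ℂ (meanC : (ι → Matrix (Fin 2) (Fin 2) ℂ) → Matrix (Fin 2) (Fin 2) ℂ)
      (fun j => (W j : Matrix (Fin 2) (Fin 2) ℂ)) :=
  analyticAt_meanC (Complex.mem_slitPlane_iff.2 (Or.inl (det_qsum_re_pos W hW)))

/-! ## 4. «sufficiently small diameters», with an explicit constant -/

/-- `det(1 + D) = 1 + tr D + det D` for `2×2` matrices. [folklore] -/
theorem det_one_add_fin_two (D : Matrix (Fin 2) (Fin 2) ℂ) : (1 + D).det = 1 + D.trace + D.det := by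
  simp only [Matrix.det_fin_two, Matrix.trace_fin_two, Matrix.add_apply, Matrix.one_apply_eq, Matrix.one_apply_ne,
    ne_eq, zero_ne_one, one_ne_zero, not_false_eq_true, Fin.isValue]
  ring

/-- `|tr D| ≤ 2‖D‖` in the operator norm. [folklore] -/
theorem norm_trace_le (D : Matrix (Fin 2) (Fin 2) ℂ) : ‖D.trace‖ ≤ 2 * ‖D‖ := by
  rw [Matrix.trace_fin_two]
  calc ‖D 0 0 + D 1 1‖ ≤ ‖D 0 0‖ + ‖D 1 1‖ := norm_add_le _ _
    _ ≤ ‖D‖ + ‖D‖ := add_le_add (norm_apply_le_norm D 0 0) (norm_apply_le_norm D 1 1)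
    _ = 2 * ‖D‖ := by ring

/-- `|det D| ≤ 2‖D‖²` in the operator norm. [folklore] -/
theorem norm_det_le (D : Matrix (Fin 2) (Fin 2) ℂ) : ‖D.det‖ ≤ 2 * ‖D‖ ^ 2 := by
  rw [Matrix.det_fin_two]
  have h := fun a b => norm_apply_le_norm D a b
  calc ‖D 0 0 * D 1 1 - D 0 1 * D 1 0‖ ≤ ‖D 0 0 * D 1 1‖ + ‖D 0 1 * D 1 0‖ := norm_sub_le _ _
    _ = ‖D 0 0‖ * ‖D 1 1‖ + ‖D 0 1‖ * ‖D 1 0‖ := by rw [norm_mul, norm_mul]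
    _ ≤ ‖D‖ * ‖D‖ + ‖D‖ * ‖D‖ :=
        add_le_add (mul_le_mul (h 0 0) (h 1 1) (norm_nonneg _) (norm_nonneg _))
          (mul_le_mul (h 0 1) (h 1 0) (norm_nonneg _) (norm_nonneg _))
    _ = 2 * ‖D‖ ^ 2 := by ring

/-- **Near the identity the sum is regular, quantitatively**: if `‖W_j - 1‖ ≤ η ≤ 1/3` for all `j` then
`Re det Σ_j W_j > 0` (indeed `≥ n²(1 - 2η - 2η²) ≥ n²/9`). [folklore] -/
theorem det_qsumC_re_pos_of_near_one [Nonempty ι] {η : ℝ} (W : ι → Matrix (Fin 2) (Fin 2) ℂ)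
    (hW : ∀ j, ‖W j - 1‖ ≤ η) (hη : η ≤ 1 / 3) : 0 < ((qsumC W).det).re := by
  have hn : (0 : ℝ) < Fintype.card ι := Nat.cast_pos.2 Fintype.card_pos
  have hnC : ((Fintype.card ι : ℕ) : ℂ) ≠ 0 := by exact_mod_cast hn.ne'
  have hη0 : 0 ≤ η := (norm_nonneg _).trans (hW (Classical.arbitrary ι))
  set D : Matrix (Fin 2) (Fin 2) ℂ := ((Fintype.card ι : ℕ) : ℂ)⁻¹ • ∑ j, (W j - 1) with hD
  have hq : qsumC W = ((Fintype.card ι : ℕ) : ℂ) • (1 + D) := by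
    rw [hD, smul_add, smul_smul, mul_inv_cancel₀ hnC, one_smul, Finset.sum_sub_distrib, Finset.sum_const,
      Finset.card_univ, Nat.cast_smul_eq_nsmul]
    unfold qsumC
    abel
  have hDn : ‖D‖ ≤ η := by
    rw [hD, norm_smul, norm_inv, Complex.norm_natCast]
    calc (Fintype.card ι : ℝ)⁻¹ * ‖∑ j, (W j - 1)‖ ≤ (Fintype.card ι : ℝ)⁻¹ * ∑ j, ‖W j - 1‖ := by
          gcongr
          exact norm_sum_le _ _
      _ ≤ (Fintype.card ι : ℝ)⁻¹ * ∑ _j : ι, η := by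
          gcongr with j
          exact hW j
      _ = η := by
          rw [Finset.sum_const, Finset.card_univ, nsmul_eq_mul]
          field_simp
  have htr : -(2 * η) ≤ (D.trace).re := by
    have h1 := (abs_le.1 (Complex.abs_re_le_norm D.trace)).1
    have h2 := norm_trace_le D
    linarith
  have hdet : -(2 * η ^ 2) ≤ (D.det).re := by
    have h1 := (abs_le.1 (Complex.abs_re_le_norm D.det)).1
    have h2 := norm_det_le D
    have h3 : ‖D‖ ^ 2 ≤ η ^ 2 := pow_le_pow_left₀ (norm_nonneg _) hDn 2
    linarith
  have hz : 0 < (1 + D.trace + D.det).re := by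
    rw [Complex.add_re, Complex.add_re, Complex.one_re]
    nlinarith
  rw [hq, Matrix.det_smul, Fintype.card_fin, det_one_add_fin_two,
    show ((Fintype.card ι : ℕ) : ℂ) ^ 2 = (((Fintype.card ι : ℝ) ^ 2 : ℝ) : ℂ) by push_cast; ring,
    Complex.re_ofReal_mul]
  exact mul_pos (pow_pos hn 2) hz

/-- Near the identity `det Σ_j W_j` lies in the slit plane. [folklore] -/
theorem det_qsumC_mem_slitPlane_of_near_one [Nonempty ι] {η : ℝ} (W : ι → Matrix (Fin 2) (Fin 2) ℂ)
    (hW : ∀ j, ‖W j - 1‖ ≤ η) (hη : η ≤ 1 / 3) : (qsumC W).det ∈ Complex.slitPlane :=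
  Complex.mem_slitPlane_iff.2 (Or.inl (det_qsumC_re_pos_of_near_one W hW hη))

/-- **«sufficiently small diameters»**: a family within operator-norm distance `η ≤ 1/3` of some `U₀ ∈ SL(2,ℂ)` in the
left-invariant chart (`‖U₀⁻¹W_j - 1‖ ≤ η ∀ j`) is regular. [cite: Balaban1987RG1, §0 p.253] -/
theorem det_qsumC_mem_slitPlane_of_near [Nonempty ι] {η : ℝ} (U₀ : Matrix (Fin 2) (Fin 2) ℂ) (hU₀ : U₀.det = 1)
    (W : ι → Matrix (Fin 2) (Fin 2) ℂ) (hW : ∀ j, ‖U₀⁻¹ * W j - 1‖ ≤ η) (hη : η ≤ 1 / 3) :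
    (qsumC W).det ∈ Complex.slitPlane := by
  have hunit : IsUnit U₀.det := by
    rw [hU₀]
    exact isUnit_one
  have e : qsumC W = U₀ * qsumC (fun j => U₀⁻¹ * W j) := by
    unfold qsumC
    rw [Finset.mul_sum]
    refine Finset.sum_congr rfl fun j _ => ?_
    rw [← Matrix.mul_assoc, Matrix.mul_nonsing_inv _ hunit, Matrix.one_mul]
  rw [e, Matrix.det_mul, hU₀, one_mul]
  exact det_qsumC_mem_slitPlane_of_near_one _ hW hη

/-- **Analyticity on small-diameter `SL(2,ℂ)`-families** (the printed domain, with this file's explicit constant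
`1/3`). [cite: Balaban1987RG1, §0 p.253] -/
theorem analyticAt_meanC_of_near [Nonempty ι] {η : ℝ} (U₀ : Matrix (Fin 2) (Fin 2) ℂ) (hU₀ : U₀.det = 1)
    (W : ι → Matrix (Fin 2) (Fin 2) ℂ) (hW : ∀ j, ‖U₀⁻¹ * W j - 1‖ ≤ η) (hη : η ≤ 1 / 3) :
    AnalyticAt ℂ (meanC : (ι → Matrix (Fin 2) (Fin 2) ℂ) → Matrix (Fin 2) (Fin 2) ℂ) W :=
  analyticAt_meanC (det_qsumC_mem_slitPlane_of_near U₀ hU₀ W hW hη)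

/-- On small-diameter `SL(2,ℂ)`-families (0.6) holds with no exceptional-set proviso. [cite: Balaban1987RG1, (0.6) p.253] -/
theorem meanC_mul_mul_of_near [Nonempty ι] {η : ℝ} (U₀ : Matrix (Fin 2) (Fin 2) ℂ) (hU₀ : U₀.det = 1)
    (u v : Matrix (Fin 2) (Fin 2) ℂ) (hu : u.det = 1) (hv : v.det = 1)
    (W : ι → Matrix (Fin 2) (Fin 2) ℂ) (hW : ∀ j, ‖U₀⁻¹ * W j - 1‖ ≤ η) (hη : η ≤ 1 / 3) :
    meanC (fun j => u * W j * v) = u * meanC W * v :=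
  meanC_mul_mul u v hu hv W (Complex.slitPlane_ne_zero (det_qsumC_mem_slitPlane_of_near U₀ hU₀ W hW hη))

end SU2Mean

end Literature.MathematicalPhysics.QuantumFieldTheory.Balaban1983to89

end
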